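import Mathlib
import Literature.Analysis.DeBrangesSpaces.Basic
import HarnessLib

/-!
# The cubic `E₀(z) = z³ + 2iz² − z − i`: its de Branges matrix `W₀` and factorisation (Suzuki 2023, §7.2, §12.2–§12.3)

Part 1 of a fully kernel-checked transcription, AS PRINTED, of the worked example of

> M. Suzuki, *Analytic theories around the simplest screw*, arXiv:2308.11860 (2023), expository
> [Suzuki2023SimplestScrew]: §7.2 (the cubic `E₀` attached to the Nevanlinna function
> `Q₀(z) = (1 − 2z²)/(z(z−1)(z+1))` of (6.4), `Θ₀ = (i − Q₀)/(i + Q₀) = E₀♯/E₀`, `E₀ ∈ HB` via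
> `P(w) = iE₀(iw) = w³ + 2w² + w + 1`), §12.2 (de Branges' 1961 recipe: a polynomial matrix
> `W = [[A,B],[C,D]]` with `W(0) = I`, (12.2) `AD − BC = 1`, (12.3) `Re[A D̄ − B C̄] ≥ 1`, (12.4) the
> two kernel inequalities, factors as `∏ₖ (I − z [[αₖ,βₖ],[βₖ,γₖ]] J)` with `αₖ, γₖ ≥ 0`,
> `αₖγₖ = βₖ²`, `αₖγ_{k−1} + γₖα_{k−1} − 2βₖβ_{k−1} > 0`), and §12.3 (the example:
> `A = D = 1 − 2z²`, `B = 4z`, `C = z³ − z`, `W₀ = (I − z·diag(0,½)J)(I − z·diag(4,0)J)(I − z·diag(0,½)J)`,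
> «`A − iB` belongs to `HB` as well as `E₀ = C − iD`»).

Here: the objects, every displayed identity of §12.3 up to the factorisation (`ring`-grade), the
hypotheses (12.2)–(12.4) checked EXACTLY for this `W₀`, and the two Hermite–Biehler claims proved
EXACTLY by the polynomial identities `|E₀(x+iy)|² − |E₀(x−iy)|² = y·(8(x²+y²)² − 4x² + 12y² + 4)` and
`|(A−iB)(x+iy)|² − |(A−iB)(x−iy)|² = y·(32x² + 32y² + 16)`, plus "no real zeros". Hermite–Biehler is
the tree's `Literature.Analysis.DeBrangesSpaces.IsHermiteBiehler` (entire + `‖E(z̄)‖ < ‖E(z)‖` on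
`ℂ₊`); with the no-real-zeros theorems this is the source's class `HB` (Def. 7.2: «NO real zeros»),
i.e. the tree's `Literature.NumberTheory.LFunctions.IsSuzukiHB` by `isSuzukiHB_iff` (not imported,
to keep this elementary file free of `ζ`). Part 2 (`CubicStructureHamiltonianFlow.lean`): the
Hamiltonian `H₀` of (12.7) and the printed fundamental solution `W(t,z)` of (12.5)/(12.6).

Purpose (cell `run/shared/lean/pub/rh-dbr`, COLUMN 6 DBR, LADDER-RH B-D instrument custody): this
example is the cell's STEP-0 anchor **P4** (two exact computational lineages, referee-signed
`rh-columns/STEP0-PASS.ok` §3); these two files are its kernel form («Lean record row in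
certificate form»). RH-FREE; a worked polynomial example; nothing here bears on the Riemann
Hypothesis.

## Design choices
* All `2 × 2` computations are reduced to literal matrices `!![a, b; c, d]` with
  `Matrix.mul_fin_two` / `Matrix.one_fin_two` and three small literal helpers (`smul_mat2`,
  `add_mat2`, `sub_mat2`), then closed entrywise by `ring` (`mat2_ext`).
* Misprint in the source, recorded where it occurs: §12.3 l.4 prints `D = (i/2)(E + E♯)` (it is
  `(i/2)(E − E♯)`, theorem `D_eq`).
* (12.4) is stated cleared of the denominator `z − z̄` (no division: the printed quotients are the
  displayed positive real polynomials).

## Deliberately NOT here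
Thm. 12.1 (= de Branges 1968, Thms. 35/40) and the general factorisation theorem of de Branges 1961
quoted in §12.2 — only their hypotheses (12.2)–(12.4) and the conclusion are checked for this `W₀`;
the root location argument of §7.2 beyond `P`'s sign changes (the HB inequality is proved directly
instead); §§2–11 of the source.

## References
* [Suzuki2023SimplestScrew] M. Suzuki, Analytic theories around the simplest screw,
  arXiv:2308.11860 (2023): (6.4), Def. 7.2, (7.6), §7.2, §12.2 (12.2)–(12.4), §12.3.
* L. de Branges, Some Hilbert spaces of entire functions II, Trans. AMS 99 (1961) 118–152 (the
  factorisation recipe quoted in §12.2; not restated).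
-/

noncomputable section

namespace Literature.Analysis.DeBrangesSpaces

-- Sub-namespace naming the object: Suzuki's cubic example attached to the simplest screw line.
namespace SimplestScrewCubic

open _root_.Complex
open scoped ComplexConjugate

/-! ## Literal `2 × 2` helpers -/

/-- Entrywise equality of literal `2 × 2` matrices. [folklore] -/
private theorem mat2_ext {a b c d a' b' c' d' : ℂ} (h₁ : a = a') (h₂ : b = b') (h₃ : c = c')
    (h₄ : d = d') : !![a, b; c, d] = !![a', b'; c', d'] := by
  subst h₁ h₂ h₃ h₄; rfl

/-- Scalar multiple of a literal `2 × 2` matrix. [folklore] -/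
private theorem smul_mat2 (k a b c d : ℂ) : k • !![a, b; c, d] = !![k * a, k * b; k * c, k * d] := by
  ext i j; fin_cases i <;> fin_cases j <;> simp

/-- Sum of literal `2 × 2` matrices. [folklore] -/
private theorem add_mat2 (a b c d a' b' c' d' : ℂ) :
    !![a, b; c, d] + !![a', b'; c', d'] = !![a + a', b + b'; c + c', d + d'] := by
  ext i j; fin_cases i <;> fin_cases j <;> simp

/-- Difference of literal `2 × 2` matrices. [folklore] -/
private theorem sub_mat2 (a b c d a' b' c' d' : ℂ) :
    !![a, b; c, d] - !![a', b'; c', d'] = !![a - a', b - b'; c - c', d - d'] := by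
  ext i j; fin_cases i <;> fin_cases j <;> simp

/-! ## §6–§7: `Q₀`, `E₀`, `P(w) = iE₀(iw)` -/

/-- `Q₀(z) = (1 − 2z²)/(z(z−1)(z+1))`, the Nevanlinna-class function of the simplest screw's
`g₀`. [cite: Suzuki2023SimplestScrew, eq. (6.4)] -/
def Q₀ (z : ℂ) : ℂ := (1 - 2 * z ^ 2) / (z * (z - 1) * (z + 1))

/-- `E₀(z) := z³ + 2iz² − z − i`, with `Θ₀ = (i − Q₀)/(i + Q₀) = E₀♯/E₀`.
[cite: Suzuki2023SimplestScrew, eq. (7.6)] -/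
def E₀ (z : ℂ) : ℂ := z ^ 3 + 2 * I * z ^ 2 - z - I

/-- `P(w) := iE₀(iw) = w³ + 2w² + w + 1` (§7.2), as a real polynomial function.
[cite: Suzuki2023SimplestScrew, §7.2] -/
def P (w : ℝ) : ℝ := w ^ 3 + 2 * w ^ 2 + w + 1

/-- `iE₀(iw) = w³ + 2w² + w + 1` for every complex `w`. [cite: Suzuki2023SimplestScrew, §7.2] -/
theorem I_mul_E₀_I_mul (w : ℂ) : I * E₀ (I * w) = w ^ 3 + 2 * w ^ 2 + w + 1 := by
  unfold E₀
  linear_combination ((I ^ 2 - 1) * (w ^ 3 + 2 * w ^ 2) - (w + 1)) * I_sq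

/-- `iE₀(iw) = P(w)` for real `w`. [cite: Suzuki2023SimplestScrew, §7.2] -/
theorem I_mul_E₀_I_mul_ofReal (w : ℝ) : I * E₀ (I * w) = (P w : ℂ) := by
  rw [I_mul_E₀_I_mul]; simp [P]

/-- The printed values `P(0) = 1`, `P(−2) = −1`, `P(−1) = 1`, `P(−1/3) = 23/27`.
[cite: Suzuki2023SimplestScrew, §7.2] -/
theorem P_values : P 0 = 1 ∧ P (-2) = -1 ∧ P (-1) = 1 ∧ P (-1 / 3) = 23 / 27 := by
  unfold P; norm_num

/-- `P′(w) = (3w + 1)(w + 1)`. [cite: Suzuki2023SimplestScrew, §7.2] -/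
theorem hasDerivAt_P (w : ℝ) : HasDerivAt P ((3 * w + 1) * (w + 1)) w := by
  have h3 : HasDerivAt (fun x : ℝ => x ^ 3) (3 * w ^ 2) w := by
    simpa using hasDerivAt_pow 3 w
  have h2 : HasDerivAt (fun x : ℝ => 2 * x ^ 2) (2 * (2 * w)) w := by
    simpa using (hasDerivAt_pow 2 w).const_mul 2
  have hs := ((h3.add h2).add (hasDerivAt_id w)).add (hasDerivAt_const w (1 : ℝ))
  have hs' : HasDerivAt P (3 * w ^ 2 + 2 * (2 * w) + 1 + 0) w :=
    hs.congr_of_eventuallyEq (Filter.Eventually.of_forall fun x => by simp [P])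
  have hval : (3 * w + 1) * (w + 1) = 3 * w ^ 2 + 2 * (2 * w) + 1 + 0 := by ring
  rw [hval]
  exact hs'

/-- `P` has a root in `(−2, 0)` (intermediate values `P(−2) = −1 < 0 < 1 = P(0)`).
[cite: Suzuki2023SimplestScrew, §7.2] -/
theorem exists_P_root : ∃ α ∈ Set.Ioo (-2 : ℝ) 0, P α = 0 := by
  have hcont : ContinuousOn P (Set.Icc (-2 : ℝ) 0) := by
    unfold P; fun_prop
  have hle : (-2 : ℝ) ≤ 0 := by norm_num
  have h0 : (0 : ℝ) ∈ Set.Ioo (P (-2)) (P 0) := by unfold P; norm_num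
  obtain ⟨α, hα, hPα⟩ := intermediate_value_Ioo hle hcont h0
  exact ⟨α, hα, hPα⟩

/-- `E₀♯(z) = −E₀(−z)` (`E♯(z) = conj (E (conj z))`, the tree's `sharp`).
[cite: Suzuki2023SimplestScrew, §12.3] -/
theorem sharp_E₀ (z : ℂ) : sharp E₀ z = -E₀ (-z) := by
  simp only [sharp, E₀, map_sub, map_add, map_mul, map_pow, Complex.conj_conj, map_ofNat,
    Complex.conj_I]
  ring

/-! ## §12.3: `A, B, C, D`, `W₀`, the factorisation -/

/-- `A(z) = 1 − 2z²`. [cite: Suzuki2023SimplestScrew, §12.3] -/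
def A (z : ℂ) : ℂ := 1 - 2 * z ^ 2

/-- `B(z) = 4z`. [cite: Suzuki2023SimplestScrew, §12.3] -/
def B (z : ℂ) : ℂ := 4 * z

/-- `C(z) = z³ − z`. [cite: Suzuki2023SimplestScrew, §12.3] -/
def C (z : ℂ) : ℂ := z ^ 3 - z

/-- `D(z) = 1 − 2z²`. [cite: Suzuki2023SimplestScrew, §12.3] -/
def D (z : ℂ) : ℂ := 1 - 2 * z ^ 2

/-- `C = ½(E₀ + E₀♯)` (odd part). [cite: Suzuki2023SimplestScrew, §12.3] -/
theorem C_eq (z : ℂ) : C z = (E₀ z + sharp E₀ z) / 2 := by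
  rw [sharp_E₀]; unfold C E₀; ring

/-- `D = (i/2)(E₀ − E₀♯)` (even part; the source prints `(i/2)(E + E♯)`, a sign misprint — with `+`
one would get `iC`). [cite: Suzuki2023SimplestScrew, §12.3] -/
theorem D_eq (z : ℂ) : D z = I / 2 * (E₀ z - sharp E₀ z) := by
  rw [sharp_E₀]; unfold D E₀
  linear_combination (1 - 2 * z ^ 2) * I_sq

/-- `E₀ = C − iD`. [cite: Suzuki2023SimplestScrew, §12.3] -/
theorem E₀_eq_C_sub_I_D (z : ℂ) : E₀ z = C z - I * D z := by
  unfold E₀ C D; ring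

/-- `D/C = Q₀` (as written; both sides take Lean's junk value `0` at `z ∈ {0, ±1}`).
[cite: Suzuki2023SimplestScrew, §12.3] -/
theorem D_div_C (z : ℂ) : D z / C z = Q₀ z := by
  unfold D C Q₀
  rw [show z * (z - 1) * (z + 1) = z ^ 3 - z by ring]

/-- `A − iB = 1 − 2z² − 4iz`. [cite: Suzuki2023SimplestScrew, §12.3] -/
theorem A_sub_I_B (z : ℂ) : A z - I * B z = 1 - 2 * z ^ 2 - 4 * I * z := by
  unfold A B; ring

/-- (12.2) for the example: `AD − BC = 1`. [cite: Suzuki2023SimplestScrew, eq. (12.2), §12.3] -/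
theorem A_mul_D_sub_B_mul_C (z : ℂ) : A z * D z - B z * C z = 1 := by
  unfold A B C D; ring

/-- Real and imaginary parts of `E₀(x + iy)`. [cite: Suzuki2023SimplestScrew, eq. (7.6)] -/
theorem E₀_mk (x y : ℝ) : E₀ ⟨x, y⟩ =
    ⟨x ^ 3 - 3 * x * y ^ 2 - 4 * x * y - x,
      3 * x ^ 2 * y - y ^ 3 + 2 * x ^ 2 - 2 * y ^ 2 - y - 1⟩ := by
  apply Complex.ext
  · simp [E₀, pow_succ, Complex.mul_re, Complex.mul_im]; ring
  · simp [E₀, pow_succ, Complex.mul_re, Complex.mul_im]; ring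

/-- (12.3) for the example, exactly: `Re[A D̄ − B C̄] = 1 + 8(x²y² + y⁴ + y²)` at `z = x + iy`.
[cite: Suzuki2023SimplestScrew, eq. (12.3), §12.3] -/
theorem re_A_mul_conj_D_sub (z : ℂ) :
    (A z * conj (D z) - B z * conj (C z)).re =
      1 + 8 * (z.re ^ 2 * z.im ^ 2 + z.im ^ 4 + z.im ^ 2) := by
  obtain ⟨x, y⟩ := z
  simp [A, B, C, D, pow_succ, Complex.mul_re, Complex.mul_im, Complex.conj_re, Complex.conj_im]
  ring

/-- (12.3) for the example: `Re[A D̄ − B C̄] ≥ 1`. [cite: Suzuki2023SimplestScrew, eq. (12.3)] -/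
theorem one_le_re_A_mul_conj_D_sub (z : ℂ) : 1 ≤ (A z * conj (D z) - B z * conj (C z)).re := by
  rw [re_A_mul_conj_D_sub]
  nlinarith [sq_nonneg z.re, sq_nonneg z.im, sq_nonneg (z.re * z.im), sq_nonneg (z.im ^ 2)]

/-- (12.4), first kernel, cleared of the denominator: `B Ā − A B̄ = (z − z̄)·(8x² + 8y² + 4)`, so
`(B Ā − A B̄)/(z − z̄) = 8|z|² + 4 ≥ 0`. [cite: Suzuki2023SimplestScrew, eq. (12.4), §12.3] -/
theorem B_mul_conj_A_sub (z : ℂ) :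
    B z * conj (A z) - A z * conj (B z) =
      (z - conj z) * ((8 * z.re ^ 2 + 8 * z.im ^ 2 + 4 : ℝ) : ℂ) := by
  obtain ⟨x, y⟩ := z
  apply Complex.ext
  · simp [A, B, pow_succ, Complex.mul_re, Complex.mul_im, Complex.conj_re, Complex.conj_im]; ring
  · simp [A, B, pow_succ, Complex.mul_re, Complex.mul_im, Complex.conj_re, Complex.conj_im]; ring

/-- (12.4), second kernel, cleared of the denominator:
`D C̄ − C D̄ = (z − z̄)·(2(x²+y²)² − x² + 3y² + 1)`, and the real factor is `> 0`.
[cite: Suzuki2023SimplestScrew, eq. (12.4), §12.3] -/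
theorem D_mul_conj_C_sub (z : ℂ) :
    D z * conj (C z) - C z * conj (D z) =
      (z - conj z) *
        ((2 * (z.re ^ 2 + z.im ^ 2) ^ 2 - z.re ^ 2 + 3 * z.im ^ 2 + 1 : ℝ) : ℂ) := by
  obtain ⟨x, y⟩ := z
  apply Complex.ext
  · simp [C, D, pow_succ, Complex.mul_re, Complex.mul_im, Complex.conj_re, Complex.conj_im]; ring
  · simp [C, D, pow_succ, Complex.mul_re, Complex.mul_im, Complex.conj_re, Complex.conj_im]; ring

/-- Positivity of the two real factors in (12.4). [cite: Suzuki2023SimplestScrew, eq. (12.4)] -/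
theorem kernel_factors_pos (x y : ℝ) :
    0 < 8 * x ^ 2 + 8 * y ^ 2 + 4 ∧ 0 < 2 * (x ^ 2 + y ^ 2) ^ 2 - x ^ 2 + 3 * y ^ 2 + 1 := by
  constructor
  · positivity
  · nlinarith [sq_nonneg (x ^ 2 - 1 / 4), sq_nonneg y, sq_nonneg x, sq_nonneg (x * y),
      sq_nonneg (y ^ 2)]

/-- `J = [[0, −1], [1, 0]]`. [cite: Suzuki2023SimplestScrew, §12.2] -/
def J : Matrix (Fin 2) (Fin 2) ℂ := !![0, -1; 1, 0]

/-- `W₀(z) = [[A, B], [C, D]] = [[1 − 2z², 4z], [z³ − z, 1 − 2z²]]`.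
[cite: Suzuki2023SimplestScrew, §12.3] -/
def W₀ (z : ℂ) : Matrix (Fin 2) (Fin 2) ℂ := !![A z, B z; C z, D z]

/-- The de Branges factor matrix `[[α,β],[β,γ]] = diag(0, ½)` of the first and third factors
(`k = 1, 3`: `α = β = 0`, `γ = ½`). [cite: Suzuki2023SimplestScrew, §12.3] -/
def N₁ : Matrix (Fin 2) (Fin 2) ℂ := !![0, 0; 0, 1 / 2]

/-- The de Branges factor matrix `[[α,β],[β,γ]] = diag(4, 0)` of the middle factor (`k = 2`:
`α = 4`, `β = γ = 0`). [cite: Suzuki2023SimplestScrew, §12.3] -/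
def N₂ : Matrix (Fin 2) (Fin 2) ℂ := !![4, 0; 0, 0]

/-- `W₀(0) = I`. [cite: Suzuki2023SimplestScrew, §12.2] -/
theorem W₀_zero : W₀ 0 = 1 := by
  rw [W₀, Matrix.one_fin_two]
  unfold A B C D
  exact mat2_ext (by ring) (by ring) (by ring) (by ring)

/-- `det W₀ = AD − BC = 1`. [cite: Suzuki2023SimplestScrew, eq. (12.2)] -/
theorem det_W₀ (z : ℂ) : (W₀ z).det = 1 := by
  rw [W₀, Matrix.det_fin_two_of, A_mul_D_sub_B_mul_C]

/-- First/third de Branges factor, literally: `I − c·diag(0,½)J = [[1, 0], [−c/2, 1]]`.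
[cite: Suzuki2023SimplestScrew, §12.3] -/
theorem one_sub_smul_N₁_mul_J (c : ℂ) :
    (1 : Matrix (Fin 2) (Fin 2) ℂ) - c • (N₁ * J) = !![1, 0; -(c / 2), 1] := by
  rw [N₁, J, Matrix.mul_fin_two, smul_mat2, Matrix.one_fin_two, sub_mat2]
  exact mat2_ext (by ring) (by ring) (by ring) (by ring)

/-- Middle de Branges factor, literally: `I − c·diag(4,0)J = [[1, 4c], [0, 1]]`.
[cite: Suzuki2023SimplestScrew, §12.3] -/
theorem one_sub_smul_N₂_mul_J (c : ℂ) :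
    (1 : Matrix (Fin 2) (Fin 2) ℂ) - c • (N₂ * J) = !![1, 4 * c; 0, 1] := by
  rw [N₂, J, Matrix.mul_fin_two, smul_mat2, Matrix.one_fin_two, sub_mat2]
  exact mat2_ext (by ring) (by ring) (by ring) (by ring)

/-- **The printed factorisation**:
`W₀(z) = (I − z·diag(0,½)J)(I − z·diag(4,0)J)(I − z·diag(0,½)J)`.
[cite: Suzuki2023SimplestScrew, §12.3] -/
theorem W₀_eq_prod (z : ℂ) :
    W₀ z = (1 - z • (N₁ * J)) * (1 - z • (N₂ * J)) * (1 - z • (N₁ * J)) := by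
  rw [one_sub_smul_N₁_mul_J, one_sub_smul_N₂_mul_J, Matrix.mul_fin_two, Matrix.mul_fin_two, W₀]
  unfold A B C D
  exact mat2_ext (by ring) (by ring) (by ring) (by ring)

/-- The de Branges conditions on the factor data `(α,β,γ) = (0,0,½), (4,0,0), (0,0,½)`:
`αₖ, γₖ ≥ 0`, `det [[αₖ,βₖ],[βₖ,γₖ]] = αₖγₖ − βₖ² = 0`, and the interlacing condition
`αₖγ_{k−1} + γₖα_{k−1} − 2βₖβ_{k−1} > 0` for `k = 2, 3` (both sides equal `2`).
[cite: Suzuki2023SimplestScrew, §12.2] -/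
theorem deBranges_factor_conditions :
    ((0 : ℝ) ≤ 0 ∧ (0 : ℝ) ≤ 1 / 2 ∧ (0 : ℝ) * (1 / 2) - 0 ^ 2 = 0) ∧
      ((0 : ℝ) ≤ 4 ∧ (0 : ℝ) ≤ 0 ∧ (4 : ℝ) * 0 - 0 ^ 2 = 0) ∧
      (0 : ℝ) < 4 * (1 / 2) + 0 * 0 - 2 * 0 * 0 ∧
      (0 : ℝ) < 0 * 0 + (1 / 2) * 4 - 2 * 0 * 0 := by
  norm_num

/-! ## Hermite–Biehler: `E₀ ∈ HB` (§7.2) and `A − iB ∈ HB` (§12.3), exactly -/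

/-- The key identity: `|E₀(z)|² − |E₀(z̄)|² = y·(8(x²+y²)² − 4x² + 12y² + 4)`, `z = x + iy`.
[cite: Suzuki2023SimplestScrew, §7.2] -/
theorem normSq_E₀_sub_normSq_E₀_conj (z : ℂ) :
    normSq (E₀ z) - normSq (E₀ (conj z)) =
      z.im * (8 * (z.re ^ 2 + z.im ^ 2) ^ 2 - 4 * z.re ^ 2 + 12 * z.im ^ 2 + 4) := by
  obtain ⟨x, y⟩ := z
  have hc : conj (⟨x, y⟩ : ℂ) = ⟨x, -y⟩ := rfl
  rw [hc, E₀_mk, E₀_mk, normSq_mk, normSq_mk]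
  ring

/-- The real factor is bounded below by `7/2`: `8(x²+y²)² − 4x² + 12y² + 4 ≥ 8(x² − ¼)² + 7/2`.
[cite: Suzuki2023SimplestScrew, §7.2] -/
theorem E₀_factor_lower_bound (x y : ℝ) :
    7 / 2 ≤ 8 * (x ^ 2 + y ^ 2) ^ 2 - 4 * x ^ 2 + 12 * y ^ 2 + 4 := by
  nlinarith [sq_nonneg (x ^ 2 - 1 / 4), sq_nonneg y, sq_nonneg (x * y), sq_nonneg (y ^ 2),
    sq_nonneg x]

/-- `E₀` has no real zeros (`E₀(x) = (x³ − x) + i(2x² − 1)`).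
[cite: Suzuki2023SimplestScrew, §7.2] -/
theorem E₀_ofReal_ne_zero (x : ℝ) : E₀ x ≠ 0 := by
  intro h
  rw [show (x : ℂ) = ⟨x, 0⟩ from rfl, E₀_mk] at h
  have h1 := congrArg Complex.re h
  have h2 := congrArg Complex.im h
  simp only [Complex.zero_re, Complex.zero_im] at h1 h2
  have h2' : x ^ 2 = 1 / 2 := by linear_combination h2 / 2
  have h1' : x * (x ^ 2 - 1) = 0 := by linear_combination h1
  rw [h2'] at h1'
  have hx : x = 0 := by linarith
  rw [hx] at h2'
  norm_num at h2'

/-- **`E₀ ∈ HB`** (inequality part): `E₀` is a Hermite–Biehler function in the tree's sense —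
entire with `‖E₀(z̄)‖ < ‖E₀(z)‖` on `ℂ₊`. The source argues via the three roots `α₁, α₂, α₃ ∈ ℂ₋`
(§7.2); here the polynomial identity `normSq_E₀_sub_normSq_E₀_conj` gives it directly. With
`E₀_ofReal_ne_zero` this is membership in the source's class `HB` (Def. 7.2, no real zeros).
[cite: Suzuki2023SimplestScrew, §7.2 and Def. 7.2] -/
theorem isHermiteBiehler_E₀ : IsHermiteBiehler E₀ where
  differentiable := by unfold E₀; fun_prop
  norm_conj_lt := by
    intro z hz
    have hkey := normSq_E₀_sub_normSq_E₀_conj z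
    have hpos : 0 < normSq (E₀ z) - normSq (E₀ (conj z)) := by
      rw [hkey]
      exact mul_pos hz (by linarith [E₀_factor_lower_bound z.re z.im])
    have hsq : ‖E₀ (conj z)‖ ^ 2 < ‖E₀ z‖ ^ 2 := by
      rw [← normSq_eq_norm_sq, ← normSq_eq_norm_sq]; linarith
    exact lt_of_pow_lt_pow_left₀ 2 (norm_nonneg _) hsq

/-- Real and imaginary parts of `(A − iB)(x + iy) = 1 − 2(x+iy)² − 4i(x+iy)`.
[cite: Suzuki2023SimplestScrew, §12.3] -/
theorem A_sub_I_B_mk (x y : ℝ) :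
    A ⟨x, y⟩ - I * B ⟨x, y⟩ = ⟨1 - 2 * (x ^ 2 - y ^ 2) + 4 * y, -4 * x * y - 4 * x⟩ := by
  apply Complex.ext
  · simp [A, B, pow_succ, Complex.mul_re, Complex.mul_im]
  · simp [A, B, pow_succ, Complex.mul_re, Complex.mul_im]; ring

/-- The identity for `A − iB = 1 − 2z² − 4iz`:
`|(A−iB)(z)|² − |(A−iB)(z̄)|² = y·(32x² + 32y² + 16)`. [cite: Suzuki2023SimplestScrew, §12.3] -/
theorem normSq_A_sub_I_B_sub (z : ℂ) :
    normSq (A z - I * B z) - normSq (A (conj z) - I * B (conj z)) =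
      z.im * (32 * z.re ^ 2 + 32 * z.im ^ 2 + 16) := by
  obtain ⟨x, y⟩ := z
  have hc : conj (⟨x, y⟩ : ℂ) = ⟨x, -y⟩ := rfl
  rw [hc, A_sub_I_B_mk, A_sub_I_B_mk, normSq_mk, normSq_mk]
  ring

/-- `A − iB` has no real zeros. [cite: Suzuki2023SimplestScrew, §12.3] -/
theorem A_sub_I_B_ofReal_ne_zero (x : ℝ) : A x - I * B x ≠ 0 := by
  intro h
  rw [show (x : ℂ) = ⟨x, 0⟩ from rfl, A_sub_I_B_mk] at h
  have h1 := congrArg Complex.re h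
  have h2 := congrArg Complex.im h
  simp only [Complex.zero_re, Complex.zero_im] at h1 h2
  have hx : x = 0 := by linarith
  rw [hx] at h1
  norm_num at h1

/-- **`A − iB ∈ HB`** («Then `A(z) − iB(z)` belongs to `HB`», §12.3): Hermite–Biehler in the tree's
sense; with `A_sub_I_B_ofReal_ne_zero`, in the source's class `HB`.
[cite: Suzuki2023SimplestScrew, §12.3] -/
theorem isHermiteBiehler_A_sub_I_B : IsHermiteBiehler (fun z => A z - I * B z) where
  differentiable := by unfold A B; fun_prop
  norm_conj_lt := by
    intro z hz
    have hkey := normSq_A_sub_I_B_sub z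
    have hpos : 0 < normSq (A z - I * B z) - normSq (A (conj z) - I * B (conj z)) := by
      rw [hkey]; positivity
    have hsq : ‖A (conj z) - I * B (conj z)‖ ^ 2 < ‖A z - I * B z‖ ^ 2 := by
      rw [← normSq_eq_norm_sq, ← normSq_eq_norm_sq]; linarith
    exact lt_of_pow_lt_pow_left₀ 2 (norm_nonneg _) hsq

end SimplestScrewCubic

end Literature.Analysis.DeBrangesSpaces

end
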